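import Literature.NumberTheory.ModularForms.ConstructionAShells
import Literature.NumberTheory.ModularForms.E6SecondShell
import HarnessLib

/-!
# Construction A: the shell `w·w = 16` of `L(C)` (norm `8` in `Λ(C)`), `N₈(E₇) = 4158` and `N₈` of `Λ(H₈)` `= 17520`
# (Conway–Sloane Ch. 7 §2 (2), Theorem 3; Ch. 4 §5 (47), Table 4.10)

Layer `Literature/NumberTheory/ModularForms`, namespace `Literature.NumberTheory.ModularForms` (lane
`lit-hodgefound`, Layer A4, theta-divisor row A4-17; prover seat `lit-hodgefound-p23`, row «A4-17(bp)»; sequel of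
`ConstructionAShells.lean` («A4-17(bk)»: the fibres `#{Φ_u = c}`, `c ≤ 3`, of `Φ_u(t) = Σ tᵢ(tᵢ + ūᵢ)`,
`natCard_coset_norm_of_eq`, the shells `w·w = 8, 12`), `E6SecondShell.lean` («A4-17(bm)»: `natCard_sumSq_eq_four :
r_m(4) = 2m + 16·C(m,4)`), `ConstructionAKissingNumber.lean` («A4-17(bh)»: `natCard_coset_zero_norm`,
`natCard_constructionA_norm_eq_sum`) and `ConstructionAE7E8.lean` («A4-17(bi)»: `E₇ = Λ(H₇)`, `E₈ = Λ(H₈)`)).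

Sources followed (held text `book:conway1999-sphere-packings-lattices-groups`, read at the quoted chunks).

* J. H. Conway, N. J. A. Sloane, *Sphere Packings, Lattices and Groups* (3rd ed. 1999), Ch. 7 §2 (1)–(2) [p0290
  L9–L22] (the centers "obtained from the codewords of `C` by adding arbitrary even numbers to the components");
  Theorem 3 (6) [p0291] (`Θ_{Λ(C)}(z) = W_C(θ₃(2z), θ₂(2z))`); Ch. 4 §5 (47) [p0216] (`r_n(m)`); Ch. 4 §8.1
  Table 4.10 [p0229 L7]: "`m = 8`: `N₈(E₆) = 936`, `N₈(E₇) = 4158`, `N₈(E₈) = 17520`"; §8.2 (112) [p0231 L37].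

## What is here (everything is a theorem; no definition, no named fact, net debt `0`)

* §1 **`natCard_coset_norm_sixteen`**: the shell `w·w = 16` over a word `u` by weight — `r_n(4) = 2n + 16C(n,4)`
  (`u = 0`, via `natCard_coset_zero_norm` and `r_m(4)`), `2⁴(8(n−4) + 8C(n−4,3))` (`wt u = 4`, the fibre `Φ_u = 3`),
  `2⁸(8 + 4C(n−8,2))` (`wt u = 8`, `Φ_u = 2`), `2¹³(n−12)` (`wt u = 12`), `2¹⁶` (`wt u = 16`), `0` otherwise.
* §2 **`natCard_constructionA_norm_sixteen`** (`#{w ∈ L(C) : w·w = 16} = (2n + 16C(n,4))A₀ + (128(n−4) +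
  128C(n−4,3))A₄ + (2048 + 1024C(n−8,2))A₈ + 8192(n−12)A₁₂ + 65536A₁₆`) and the `0 ∈ C` form.
* §3 `natCard_constructionA_H7_norm_sixteen` (`574 + 7·512 = 4158`), **`natCard_cartanMatrixE₇_norm_eight :
  #{x ∈ ℤ⁷ : ᵗx E₇ x = 8} = 4158`** (Table 4.10, the coefficient of `q⁸` of (112)), and on the code side
  `natCard_constructionA_H8_norm_sixteen` (`1136 + 14·1024 + 2048 = 17520` = Table 4.10's `N₈(E₈)`; on
  `CartanMatrix.E₈` this is the tree's `natCard_cartanMatrixE₈_shells` and is not restated).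

Not here: `N₈(E₆) = 936`; shells `w·w ≥ 20` of a general `L(C)` (they need the fibres `Φ_u = c`, `c ≥ 4`, `u ≠ 0`).

## References

* [ConwaySloane1999] J. H. Conway, N. J. A. Sloane, *Sphere Packings, Lattices and Groups*, 3rd ed., Springer
  (1999), Ch. 7 §2 (1)–(2), Theorem 3 (6) (pp. 182–183; held chunks p0290–p0291); Ch. 4 §5 (47) (p. 108; held chunk
  p0216), §8.1 Table 4.10 (p. 123; held chunk p0229), §8.2 (112) (p. 125; held chunk p0231).
-/
noncomputable section

open Matrix Finset

namespace Literature.NumberTheory.ModularForms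

variable {n : ℕ}

/-! ### §1 The shell `w·w = 16` over a word `u`, by weight -/

section ShellSixteen

/-- `wt(u) + #{i : uᵢ = 0} = n`. [folklore] -/
private theorem weight_add_card_zero' (u : Fin n → ZMod 2) :
    (Finset.univ.filter fun i => u i ≠ 0).card + (Finset.univ.filter fun i => u i = 0).card = n := by
  have h := Finset.card_filter_add_card_filter_not (s := (Finset.univ : Finset (Fin n))) (fun i => u i ≠ 0)
  rw [Finset.card_univ, Fintype.card_fin] at h
  have h' : (Finset.univ.filter fun i => ¬ (u i ≠ 0)) = Finset.univ.filter fun i => u i = 0 :=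
    Finset.filter_congr fun i _ => not_not
  rw [h'] at h
  exact h

/-- A word of weight `0` is the zero word. [folklore] -/
private theorem eq_zero_of_weight_eq_zero {u : Fin n → ZMod 2} (h : (Finset.univ.filter fun i => u i ≠ 0).card = 0) :
    u = 0 := by
  rw [Finset.card_eq_zero, Finset.filter_eq_empty_iff] at h
  funext i
  exact not_not.1 (h (Finset.mem_univ i))

/-- **The shell `w·w = 16` over a word `u`** (norm `8` in `Λ(C)`): `r_n(4) = 2n + 16·C(n,4)` vectors if `u = 0` (the
`2(±2, 0, …)` and `2(±1)⁴0^{n−4}`), `2⁴(8(n−4) + 8·C(n−4,3))` if `wt(u) = 4`, `2⁸(8 + 4·C(n−8,2))` if `wt(u) = 8`,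
`2¹²·2(n−12)` if `wt(u) = 12`, `2¹⁶` if `wt(u) = 16`, none otherwise.
[cite: ConwaySloane1999, Ch. 7 §2 (2), Theorem 3 (6) (p0290–p0291); Ch. 4 §5 (47) (p0216)] -/
theorem natCard_coset_norm_sixteen (u : Fin n → ZMod 2) :
    Nat.card {w : Fin n → ℤ // (fun i => (w i : ZMod 2)) = u ∧ w ⬝ᵥ w = 16} =
      (if (Finset.univ.filter fun i => u i ≠ 0).card = 0 then 2 * n + 16 * n.choose 4 else 0) +
        (if (Finset.univ.filter fun i => u i ≠ 0).card = 4 then 128 * (n - 4) + 128 * (n - 4).choose 3 else 0) +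
          (if (Finset.univ.filter fun i => u i ≠ 0).card = 8 then 2048 + 1024 * (n - 8).choose 2 else 0) +
            (if (Finset.univ.filter fun i => u i ≠ 0).card = 12 then 8192 * (n - 12) else 0) +
              (if (Finset.univ.filter fun i => u i ≠ 0).card = 16 then 65536 else 0) := by
  have hkj := weight_add_card_zero' u
  by_cases hk0 : (Finset.univ.filter fun i => u i ≠ 0).card = 0
  · have hu0 := eq_zero_of_weight_eq_zero hk0
    subst hu0
    rw [show (16 : ℤ) = 4 * 4 by norm_num, natCard_coset_zero_norm, natCard_sumSq_eq_four]
    simp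
  by_cases hk4 : (Finset.univ.filter fun i => u i ≠ 0).card = 4
  · rw [natCard_coset_norm_of_eq u (c := 3) (by rw [hk4]; norm_num), (natCard_phi_fiber u).2.2.2, hk4,
      show (Finset.univ.filter fun i => u i = 0).card = n - 4 by omega, if_neg (by norm_num), if_pos rfl,
      if_neg (by norm_num), if_neg (by norm_num), if_neg (by norm_num)]
    ring
  by_cases hk8 : (Finset.univ.filter fun i => u i ≠ 0).card = 8
  · rw [natCard_coset_norm_of_eq u (c := 2) (by rw [hk8]; norm_num), (natCard_phi_fiber u).2.2.1, hk8,
      show (Finset.univ.filter fun i => u i = 0).card = n - 8 by omega, if_neg (by norm_num), if_neg (by norm_num),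
      if_pos rfl, if_neg (by norm_num), if_neg (by norm_num)]
    ring
  by_cases hk12 : (Finset.univ.filter fun i => u i ≠ 0).card = 12
  · rw [natCard_coset_norm_of_eq u (c := 1) (by rw [hk12]; norm_num), (natCard_phi_fiber u).2.1, hk12,
      show (Finset.univ.filter fun i => u i = 0).card = n - 12 by omega]
    norm_num; ring
  by_cases hk16 : (Finset.univ.filter fun i => u i ≠ 0).card = 16
  · rw [natCard_coset_norm_of_eq u (c := 0) (by rw [hk16]; norm_num), (natCard_phi_fiber u).1, hk16]
    norm_num
  rw [if_neg hk0, if_neg hk4, if_neg hk8, if_neg hk12, if_neg hk16]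
  by_cases hdvd : (4 : ℤ) ∣ 16 - ((Finset.univ.filter fun i => u i ≠ 0).card : ℤ)
  · obtain ⟨c, hc⟩ := hdvd
    exact natCard_coset_norm_eq_zero_of_lt u (c := c) (by linarith) (by omega)
  · exact natCard_coset_norm_eq_zero_of_not_dvd u hdvd

end ShellSixteen

/-! ### §2 The shell `w·w = 16` of `L(C)` -/

section Code

variable (C : Finset (Fin n → ZMod 2))

/-- `Σ_{u ∈ C} [wt u = m]·a = a·A_m`. [folklore] -/
private theorem sum_ite_weight_eq' (m a : ℕ) :
    ∑ u ∈ C, (if (Finset.univ.filter fun i => u i ≠ 0).card = m then a else 0) =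
      a * (C.filter fun u => (Finset.univ.filter fun i => u i ≠ 0).card = m).card := by
  rw [Finset.sum_ite, Finset.sum_const_zero, add_zero, Finset.sum_const, smul_eq_mul, mul_comm]

/-- **The shell `w·w = 16` of `L(C)` (norm `8` in `Λ(C)`, the coefficient of `q⁸` in `W_C(θ₃(2z), θ₂(2z))`)**:
`#{w ∈ L(C) : w·w = 16} = (2n + 16C(n,4))A₀ + (128(n−4) + 128C(n−4,3))A₄ + (2048 + 1024C(n−8,2))A₈ + 8192(n−12)A₁₂
+ 65536A₁₆`. [cite: ConwaySloane1999, Ch. 7 §2 (2), Theorem 3 (6) (p0290–p0291); Ch. 4 §8.1 Table 4.10 (p0229)] -/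
theorem natCard_constructionA_norm_sixteen :
    Nat.card {w : Fin n → ℤ // (fun i => (w i : ZMod 2)) ∈ C ∧ w ⬝ᵥ w = 16} =
      (2 * n + 16 * n.choose 4) * (C.filter fun u => (Finset.univ.filter fun i => u i ≠ 0).card = 0).card +
        (128 * (n - 4) + 128 * (n - 4).choose 3) *
            (C.filter fun u => (Finset.univ.filter fun i => u i ≠ 0).card = 4).card +
          (2048 + 1024 * (n - 8).choose 2) * (C.filter fun u => (Finset.univ.filter fun i => u i ≠ 0).card = 8).card +
            8192 * (n - 12) * (C.filter fun u => (Finset.univ.filter fun i => u i ≠ 0).card = 12).card +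
              65536 * (C.filter fun u => (Finset.univ.filter fun i => u i ≠ 0).card = 16).card := by
  rw [natCard_constructionA_norm_eq_sum C 16]
  simp_rw [natCard_coset_norm_sixteen]
  rw [Finset.sum_add_distrib, Finset.sum_add_distrib, Finset.sum_add_distrib, Finset.sum_add_distrib,
    sum_ite_weight_eq', sum_ite_weight_eq', sum_ite_weight_eq', sum_ite_weight_eq', sum_ite_weight_eq']

/-- `A₀ = 1` for a code containing `0`. [folklore] -/
private theorem card_filter_weight_zero' (h0 : (0 : Fin n → ZMod 2) ∈ C) :
    (C.filter fun u => (Finset.univ.filter fun i => u i ≠ 0).card = 0).card = 1 := by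
  have h : (C.filter fun u => (Finset.univ.filter fun i => u i ≠ 0).card = 0) = C.filter fun u => u = 0 := by
    refine Finset.filter_congr fun u _ => ?_
    constructor
    · exact eq_zero_of_weight_eq_zero
    · rintro rfl; simp
  rw [h, Finset.filter_eq' C 0, if_pos h0, Finset.card_singleton]

/-- `A_m = 0` for `m > n`. [folklore] -/
private theorem card_filter_weight_eq_zero_of_lt' {m : ℕ} (hm : n < m) :
    (C.filter fun u => (Finset.univ.filter fun i => u i ≠ 0).card = m).card = 0 := by
  rw [Finset.card_eq_zero, Finset.filter_eq_empty_iff]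
  intro u _ hu
  have h := Finset.card_filter_le (Finset.univ : Finset (Fin n)) (fun i => u i ≠ 0)
  rw [Finset.card_univ, Fintype.card_fin, hu] at h
  omega

/-- **For a code containing `0`**: `#{w ∈ L(C) : w·w = 16} = 2n + 16C(n,4) + (128(n−4) + 128C(n−4,3))A₄ +
(2048 + 1024C(n−8,2))A₈ + 8192(n−12)A₁₂ + 65536A₁₆`. [cite: ConwaySloane1999, Ch. 7 §2 (2), Theorem 3 (6) (p0290–p0291); Ch. 4 §8.1 Table 4.10 (p0229)] -/
theorem natCard_constructionA_norm_sixteen_of_zero_mem (h0 : (0 : Fin n → ZMod 2) ∈ C) :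
    Nat.card {w : Fin n → ℤ // (fun i => (w i : ZMod 2)) ∈ C ∧ w ⬝ᵥ w = 16} =
      2 * n + 16 * n.choose 4 +
        (128 * (n - 4) + 128 * (n - 4).choose 3) *
            (C.filter fun u => (Finset.univ.filter fun i => u i ≠ 0).card = 4).card +
          (2048 + 1024 * (n - 8).choose 2) * (C.filter fun u => (Finset.univ.filter fun i => u i ≠ 0).card = 8).card +
            8192 * (n - 12) * (C.filter fun u => (Finset.univ.filter fun i => u i ≠ 0).card = 12).card +
              65536 * (C.filter fun u => (Finset.univ.filter fun i => u i ≠ 0).card = 16).card := by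
  rw [natCard_constructionA_norm_sixteen, card_filter_weight_zero' C h0, mul_one]

end Code

/-! ### §3 `N₈(E₇) = 4158` and `N₈` of `Λ(H₈)` -/

section E7

/-- **`#{w ∈ L(H₇) : w·w = 16} = (14 + 16·35) + (128·3 + 128)·7 = 574 + 3584 = 4158`.** [cite: ConwaySloane1999, Ch. 4 §8.1 Table 4.10 ("N₈(E₇) = 4158") (p0229)] -/
theorem natCard_constructionA_H7_norm_sixteen :
    Nat.card {w : Fin 7 → ℤ // (fun i => (w i : ZMod 2)) ∈
        ({0, ![0, 0, 1, 1, 1, 0, 1], ![0, 1, 0, 0, 1, 1, 1], ![0, 1, 1, 1, 0, 1, 0], ![1, 0, 0, 1, 1, 1, 0],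
          ![1, 0, 1, 0, 0, 1, 1], ![1, 1, 0, 1, 0, 0, 1], ![1, 1, 1, 0, 1, 0, 0]} : Finset (Fin 7 → ZMod 2)) ∧
        w ⬝ᵥ w = 16} = 4158 := by
  rw [natCard_constructionA_norm_sixteen_of_zero_mem _ (zero_mem_H7 rfl), card_filter_H7_weight_four rfl,
    card_filter_weight_eq_zero_of_lt' _ (by norm_num), card_filter_weight_eq_zero_of_lt' _ (by norm_num),
    card_filter_weight_eq_zero_of_lt' _ (by norm_num)]
  decide

/-- **Table 4.10: `E₇` has `4158` vectors of norm `8`** — `#{x ∈ ℤ⁷ : ᵗx E₇ x = 8} = 4158` for Mathlib's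
`CartanMatrix.E₇` (the coefficient of `q⁸` of (112)). [cite: ConwaySloane1999, Ch. 4 §8.1 Table 4.10 ("N₈(E₇) = 4158") (p0229); §8.2 (112) (p0231)] -/
theorem natCard_cartanMatrixE₇_norm_eight :
    Nat.card {x : Fin 7 → ℤ // x ⬝ᵥ CartanMatrix.E₇ *ᵥ x = 8} = 4158 := by
  rw [natCard_gram₂_repr (B7mat_mul_transpose rfl) (B7mat_vecMul_injective rfl rfl) (range_B7mat_vecMul rfl rfl rfl) 8,
    show (2 : ℤ) * 8 = 16 by norm_num, natCard_constructionA_H7_norm_sixteen]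

end E7

section E8

variable {C : Finset (Fin 8 → ZMod 2)}
  (hC : C = {0, ![0, 0, 0, 1, 1, 1, 1, 0], ![0, 0, 1, 0, 1, 1, 0, 1], ![0, 0, 1, 1, 0, 0, 1, 1],
    ![0, 1, 0, 0, 1, 0, 1, 1], ![0, 1, 0, 1, 0, 1, 0, 1], ![0, 1, 1, 0, 0, 1, 1, 0], ![0, 1, 1, 1, 1, 0, 0, 0],
    ![1, 0, 0, 0, 0, 1, 1, 1], ![1, 0, 0, 1, 1, 0, 0, 1], ![1, 0, 1, 0, 1, 0, 1, 0], ![1, 0, 1, 1, 0, 1, 0, 0],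
    ![1, 1, 0, 0, 1, 1, 0, 0], ![1, 1, 0, 1, 0, 0, 1, 0], ![1, 1, 1, 0, 0, 0, 0, 1], ![1, 1, 1, 1, 1, 1, 1, 1]})

include hC in
/-- **`#{w ∈ L(H₈) : w·w = 16} = (16 + 16·70) + (128·4 + 128·4)·14 + 2048 = 17520`** — the fourth shell of
`E₈ = Λ(H₈)` on the code side (Table 4.10 `N₈(E₈) = 17520`; on `CartanMatrix.E₈` this is the tree's
`natCard_cartanMatrixE₈_shells`). [cite: ConwaySloane1999, Ch. 4 §8.1 Table 4.10 ("N₈(E₈) = 17520") (p0229); Ch. 7 §2 Example 5 (14) (p0292)] -/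
theorem natCard_constructionA_H8_norm_sixteen :
    Nat.card {w : Fin 8 → ℤ // (fun i => (w i : ZMod 2)) ∈ C ∧ w ⬝ᵥ w = 16} = 17520 := by
  rw [natCard_constructionA_norm_sixteen_of_zero_mem _ (zero_mem_H8 hC), card_filter_H8_weight_four hC,
    (card_filter_H8_weight_zero_eight hC).2, card_filter_weight_eq_zero_of_lt' _ (by norm_num),
    card_filter_weight_eq_zero_of_lt' _ (by norm_num)]
  decide

end E8

end Literature.NumberTheory.ModularForms

end
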